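import Summits.CriticalPhenomena.PercolationContinuityZ3.Theorems.PercNearOneGluingNoHeavyLowerTailSahiCTCRtThreeDealForm
import Mathlib.Combinatorics.Hall.Basic
import HarnessLib

/-!
# `NoHeavyLowerTail` (crux stmt-CriticalPhenomena-4575), P3 lane: the DEAL REDUCTION for the squarefree row of `R_3 ∈ ℕ[s]` —
# Kleitman matchings of `𝒵` alone bound `KL(X₃,𝒵)` below, and ONE dealing certificate for `𝒵` proves `[s^V] R_3(𝒳,𝒵) ≥ 0` for EVERY `𝒳`

Support file (seat `prim-l12-p3`, gen 47; `--supports stmt-CriticalPhenomena-4575`).  Memo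
`run/shared/lean/prim/prim-l12/FROM-prim-l12-p3-g47-TRANSPORT-CERTIFICATES.md` §4.

For a family `𝒵` and a cube `W` let `Dcl 𝒵 W = {Q ⊆ W : Q ∉ 𝒵, W∖Q ∈ 𝒵}` and `Ccl 𝒵 W = {Q ⊆ W : Q ∈ 𝒵, W∖Q ∉ 𝒵}` (the complement map is a bijection
`Dcl → Ccl`; for an up-set `𝒵`, Kleitman's lemma + Hall give an INCREASING injection `M : Dcl → Ccl`, `Q ⊊ M Q`).  This file proves:
* `kap_empty_eq_card_sub_card` : `κ(A,𝒵)(∅,W) = #(Ccl 𝒵 W ∩ A) − #(Dcl 𝒵 W ∩ A)` for every family `A`;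
* `exists_increasing_injection_Dcl` : for an up-set `𝒵` such an increasing injection `M : Dcl → Ccl` EXISTS in every cube (Kleitman's lemma
  `kap_nonneg` is exactly Hall's condition for `N ↦ {Q' ∈ Ccl : N ⊆ Q'}`; Hall's marriage theorem from Mathlib);
* `card_credits_le_kap` (**(II)** of the memo): for an up-set `𝒳` and ANY map `M` that is injective on `Dcl 𝒵 W` with `Q ⊆ M Q ∈ Ccl 𝒵 W`,
  `#{N ∈ Dcl 𝒵 W : #N ≤ 2, M N ∈ X₃} ≤ κ(X₃, 𝒵)(∅, W)`  (`X₃ = atLeast 3 𝒳` has no small members, so the images of small `N` are surplus);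
* `sum_pairsAt_below_atLeast_eq`, `sum_pairsAt_below_below_eq` : the two debt blocks of the deal form (`…RtThreeDealForm`) re-indexed by the small
  members `P` of `𝒳`: `Σ_U #pairs(X_{<3},Z₃)(V∖U) = Σ_P tDebt`, `Σ_S #pairs(X_{<3},Z_{<3})(V∖S) = Σ_P eCred`;
* **`coeff_ind_Rt_three_nonneg_of_deal`** (**(III)**, the DEAL REDUCTION): let `V` be a finset, `𝒳` an up-set, `𝒵` any family.  Suppose maps
  `M U : Finset α → Finset α` (`U ⊆ V`, `#U ≤ 2`) are injective on `Dcl 𝒵 (V∖U)` with `N ⊆ M U N ∈ Ccl 𝒵 (V∖U)`, and a map `pay` assigns to each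
  CREDIT `(U,N)` (`N ∈ Dcl 𝒵 (V∖U)`, `#N ≤ 2`, `3 ≤ #(M U N)`) a set `pay (U,N) ⊆ M U N`, such that every small member `P` of `𝒳` inside `V` is paid
  at least its debt: `tDebt V 𝒵 P − eCred V 𝒵 P ≤ #{credits with pay = P}`.  THEN `0 ≤ [s^V] R_3(𝒳,𝒵)`.
  The hypothesis mentions `𝒳` only through WHICH small sets must be paid; a dealing that pays every pair of `V` (a `𝒵`-only object, memo (DEAL))
  therefore certifies the squarefree row for every loop-free up-set `𝒳` at once.
Nothing is asserted about the crux; (DEAL) itself (existence of `M`, `pay` for every `𝒵`) is the memo's conjecture, verified for k ≤ 8.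
-/

noncomputable section

open scoped Classical

namespace Summit.CriticalPhenomena.PercolationContinuityZ3.Theorems.SahiCTCForms

open Finset MvPolynomial SahiCTCGenFun

variable {α : Type*} [DecidableEq α] [Fintype α]

/-! ### The cube classes `Dcl`, `Ccl` and the Kleitman surplus -/

/-- `Dcl 𝒵 W = {Q ⊆ W : Q ∉ 𝒵 ∧ W∖Q ∈ 𝒵}` — non-members whose complement in the cube is a member ("debits"). [this work] -/
def Dcl (G : Finset (Finset α)) (W : Finset α) : Finset (Finset α) := W.powerset.filter fun Q => Q ∉ G ∧ W \ Q ∈ G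

/-- `Ccl 𝒵 W = {Q ⊆ W : Q ∈ 𝒵 ∧ W∖Q ∉ 𝒵}` — members whose complement in the cube is a non-member ("credits"). [this work] -/
def Ccl (G : Finset (Finset α)) (W : Finset α) : Finset (Finset α) := W.powerset.filter fun Q => Q ∈ G ∧ W \ Q ∉ G

omit [Fintype α] in
/-- Membership in `Dcl`. [this work] -/
theorem mem_Dcl {G : Finset (Finset α)} {W Q : Finset α} : Q ∈ Dcl G W ↔ Q ⊆ W ∧ Q ∉ G ∧ W \ Q ∈ G := by
  rw [Dcl, mem_filter, mem_powerset]

omit [Fintype α] in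
/-- Membership in `Ccl`. [this work] -/
theorem mem_Ccl {G : Finset (Finset α)} {W Q : Finset α} : Q ∈ Ccl G W ↔ Q ⊆ W ∧ Q ∈ G ∧ W \ Q ∉ G := by
  rw [Ccl, mem_filter, mem_powerset]

omit [Fintype α] in
/-- **`κ(A,𝒵)(∅,W) = #(Ccl 𝒵 W ∩ A) − #(Dcl 𝒵 W ∩ A)`**: on the top cube `2^W`, the Kleitman surplus of any family `A` against `𝒵` is the number of
`𝒵`-credits in `A` minus the number of `𝒵`-debits in `A` (memo §1 FACT). [this work] -/
theorem kap_empty_eq_card_sub_card (A G : Finset (Finset α)) (W : Finset α) :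
    kap A G ∅ W = (#((Ccl G W).filter fun Q => Q ∈ A) : ℤ) - #((Dcl G W).filter fun Q => Q ∈ A) := by
  unfold kap
  set T := tr A ∅ W with hT
  have hmemT : ∀ Q, Q ∈ T ↔ Q ⊆ W ∧ Q ∈ A := fun Q => by rw [hT, mem_tr_empty]
  have hmemG : ∀ Q, Q ∈ tr G ∅ W ↔ Q ⊆ W ∧ Q ∈ G := fun Q => by rw [mem_tr_empty]
  -- split both counts of the definition along `W \ Q ∈ G` resp. `Q ∈ G`
  have h1 : #(T ∩ tr G ∅ W) = #(T.filter fun Q => Q ∈ G ∧ W \ Q ∈ G) + #(T.filter fun Q => Q ∈ G ∧ W \ Q ∉ G) := by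
    rw [← card_union_of_disjoint (disjoint_filter.2 fun Q _ h1 h2 => h2.2 h1.2)]
    congr 1; ext Q
    simp only [mem_inter, mem_union, mem_filter, hmemT, hmemG]
    tauto
  have h2 : #(T.filter fun Q => W \ Q ∈ tr G ∅ W) =
      #(T.filter fun Q => Q ∈ G ∧ W \ Q ∈ G) + #(T.filter fun Q => Q ∉ G ∧ W \ Q ∈ G) := by
    rw [← card_union_of_disjoint (disjoint_filter.2 fun Q _ h1 h2 => h2.1 h1.1)]
    congr 1; ext Q
    simp only [mem_filter, mem_union, hmemT, hmemG, sdiff_subset, true_and]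
    tauto
  have h3 : (T.filter fun Q => Q ∈ G ∧ W \ Q ∉ G) = (Ccl G W).filter fun Q => Q ∈ A := by
    ext Q; simp only [mem_filter, hmemT, mem_Ccl]; tauto
  have h4 : (T.filter fun Q => Q ∉ G ∧ W \ Q ∈ G) = (Dcl G W).filter fun Q => Q ∈ A := by
    ext Q; simp only [mem_filter, hmemT, mem_Dcl]; tauto
  rw [h1, h2, h3, h4]; push_cast; ring

omit [Fintype α] in
/-- **(II) Credits are surplus**: for an up-set `𝒳`, any family `𝒵`, and any map `M` injective on `Dcl 𝒵 W` with `N ⊆ M N ∈ Ccl 𝒵 W` (an increasing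
injection of debits into credits — one exists by Kleitman + Hall), the number of SMALL debits (`#N ≤ 2`) whose image lies in `X₃ = atLeast 3 𝒳` is at most
the Kleitman surplus `κ(X₃,𝒵)(∅,W)`. [this work] -/
theorem card_credits_le_kap {F : Finset (Finset α)} (hF : IsUpperSet (F : Set (Finset α))) (G : Finset (Finset α)) (W : Finset α)
    (M : Finset α → Finset α) (hMC : ∀ N ∈ Dcl G W, M N ∈ Ccl G W) (hMsub : ∀ N ∈ Dcl G W, N ⊆ M N)
    (hMinj : Set.InjOn M (Dcl G W : Set (Finset α))) :
    (#((Dcl G W).filter fun N => #N ≤ 2 ∧ M N ∈ atLeast 3 F) : ℤ) ≤ kap (atLeast 3 F) G ∅ W := by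
  rw [kap_empty_eq_card_sub_card]
  set D₁ := (Dcl G W).filter fun Q => Q ∈ atLeast 3 F
  set D₂ := (Dcl G W).filter fun N => #N ≤ 2 ∧ M N ∈ atLeast 3 F
  have hdisj : Disjoint D₁ D₂ := by
    refine disjoint_filter.2 fun Q _ h1 h2 => ?_
    have h3 : 3 ≤ #Q := (mem_filter.1 h1).2
    have h4 : #Q ≤ 2 := h2.1
    omega
  have himg : (D₁ ∪ D₂).image M ⊆ (Ccl G W).filter fun Q => Q ∈ atLeast 3 F := by
    intro Q hQ
    obtain ⟨N, hN, rfl⟩ := mem_image.1 hQ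
    rcases mem_union.1 hN with h | h
    · obtain ⟨hND, hNF⟩ := mem_filter.1 h
      refine mem_filter.2 ⟨hMC N hND, ?_⟩
      simp only [atLeast, mem_filter] at hNF ⊢
      exact ⟨hF (hMsub N hND) hNF.1, hNF.2.trans (card_le_card (hMsub N hND))⟩
    · obtain ⟨hND, _, hMN⟩ := mem_filter.1 h
      exact mem_filter.2 ⟨hMC N hND, hMN⟩
  have hinj : Set.InjOn M ((D₁ ∪ D₂ : Finset (Finset α)) : Set (Finset α)) := fun x hx y hy h =>
    hMinj (by rcases mem_union.1 (mem_coe.1 hx) with h' | h' <;> exact (mem_filter.1 h').1)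
      (by rcases mem_union.1 (mem_coe.1 hy) with h' | h' <;> exact (mem_filter.1 h').1) h
  have hcard := card_le_card himg
  rw [card_image_of_injOn hinj, card_union_of_disjoint hdisj] at hcard
  have : (#D₁ : ℤ) + #D₂ ≤ #((Ccl G W).filter fun Q => Q ∈ atLeast 3 F) := by exact_mod_cast hcard
  linarith

/-! ### Existence of the increasing injections (Kleitman + Hall) -/

/-- **Kleitman's lemma as a matching**: for up-sets `𝒵`, in every cube `2^W` there is a map `M`, injective on `Dcl 𝒵 W`, with `N ⊆ M N ∈ Ccl 𝒵 W` —
an increasing injection of the debits into the credits.  Proof: Hall's condition for `N ↦ {Q' ∈ Ccl : N ⊆ Q'}` at a set `s` of debits is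
`#s ≤ #(Dcl ∩ A) ≤ #(Ccl ∩ A)` for the up-set `A` generated by `s`, i.e. `κ(A,𝒵)(∅,W) ≥ 0` (`kap_nonneg`). [this work] -/
theorem exists_increasing_injection_Dcl {G : Finset (Finset α)} (hG : IsUpperSet (G : Set (Finset α))) (W : Finset α) :
    ∃ M : Finset α → Finset α, (∀ N ∈ Dcl G W, M N ∈ Ccl G W) ∧ (∀ N ∈ Dcl G W, N ⊆ M N) ∧ Set.InjOn M (Dcl G W : Set (Finset α)) := by
  -- Hall's marriage theorem on the index type of debits
  set ι := {N : Finset α // N ∈ Dcl G W}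
  let t : ι → Finset (Finset α) := fun N => (Ccl G W).filter fun Q => (N : Finset α) ⊆ Q
  have hall : ∀ s : Finset ι, #s ≤ #(s.biUnion t) := by
    intro s
    -- the up-set generated by `s`
    let A : Finset (Finset α) := univ.filter fun Q => ∃ N ∈ s, (N : Finset α) ⊆ Q
    have hA : IsUpperSet (A : Set (Finset α)) := by
      intro Q Q' hQQ' hQ
      have hQ' : Q ∈ A := hQ
      obtain ⟨N, hN, hNQ⟩ := (mem_filter.1 hQ').2
      exact mem_filter.2 ⟨mem_univ _, N, hN, hNQ.trans hQQ'⟩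
    have hk : 0 ≤ kap A G ∅ W := kap_nonneg hA hG W ∅ (disjoint_empty_left W)
    rw [kap_empty_eq_card_sub_card] at hk
    have h1 : #s ≤ #((Dcl G W).filter fun Q => Q ∈ A) := by
      rw [← card_map ⟨Subtype.val, Subtype.val_injective⟩]
      refine card_le_card fun Q hQ => ?_
      obtain ⟨N, hN, rfl⟩ := mem_map.1 hQ
      exact mem_filter.2 ⟨N.2, mem_filter.2 ⟨mem_univ _, N, hN, Subset.rfl⟩⟩
    have h2 : ((Ccl G W).filter fun Q => Q ∈ A) ⊆ s.biUnion t := by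
      intro Q hQ
      obtain ⟨hQC, hQA⟩ := mem_filter.1 hQ
      obtain ⟨N, hN, hNQ⟩ := (mem_filter.1 hQA).2
      exact mem_biUnion.2 ⟨N, hN, mem_filter.2 ⟨hQC, hNQ⟩⟩
    have h3 := card_le_card h2
    have h4 : (#((Dcl G W).filter fun Q => Q ∈ A) : ℤ) ≤ #((Ccl G W).filter fun Q => Q ∈ A) := by linarith
    have h4' : #((Dcl G W).filter fun Q => Q ∈ A) ≤ #((Ccl G W).filter fun Q => Q ∈ A) := by exact_mod_cast h4
    omega
  obtain ⟨f, hfinj, hft⟩ := (all_card_le_biUnion_card_iff_exists_injective t).1 hall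
  refine ⟨fun N => if h : N ∈ Dcl G W then f ⟨N, h⟩ else N, fun N hN => ?_, fun N hN => ?_, fun N hN N' hN' h => ?_⟩
  · simp only [dif_pos hN]; exact (mem_filter.1 (hft ⟨N, hN⟩)).1
  · simp only [dif_pos hN]; exact (mem_filter.1 (hft ⟨N, hN⟩)).2
  · have hN₀ : N ∈ Dcl G W := hN
    have hN₀' : N' ∈ Dcl G W := hN'
    simp only [dif_pos hN₀, dif_pos hN₀'] at h
    exact congrArg Subtype.val (hfinj h)

/-! ### Re-indexing the two debt blocks of the deal form by the small members of `𝒳` -/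

omit [Fintype α] in
/-- `#pairs(A,B)(T) = #{P ∈ A : P ⊆ T, T∖P ∈ B}` (the second component of a partitioning pair is determined). [this work] -/
theorem pairsAt_eq_card_filter (A B : Finset (Finset α)) (T : Finset α) :
    pairsAt A B T = #(A.filter fun P => P ⊆ T ∧ T \ P ∈ B) := by
  unfold pairsAt
  refine card_bij (fun PQ _ => PQ.1) (fun PQ hPQ => ?_) (fun PQ hPQ PQ' hPQ' h => ?_) (fun P hP => ?_)
  · obtain ⟨hAB, hdis, hun⟩ := mem_filter.1 hPQ
    have hP : PQ.1 ⊆ T := hun ▸ subset_union_left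
    have hQ : T \ PQ.1 = PQ.2 := by
      rw [← hun, union_sdiff_left, Finset.sdiff_eq_self_iff_disjoint]; exact hdis.symm
    exact mem_filter.2 ⟨(mem_product.1 hAB).1, hP, hQ ▸ (mem_product.1 hAB).2⟩
  · obtain ⟨_, hdis, hun⟩ := mem_filter.1 hPQ
    obtain ⟨_, hdis', hun'⟩ := mem_filter.1 hPQ'
    have h2 : PQ.2 = T \ PQ.1 := by
      rw [← hun, union_sdiff_left]; exact (Finset.sdiff_eq_self_iff_disjoint.2 hdis.symm).symm
    have h2' : PQ'.2 = T \ PQ'.1 := by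
      rw [← hun', union_sdiff_left]; exact (Finset.sdiff_eq_self_iff_disjoint.2 hdis'.symm).symm
    exact Prod.ext h (by rw [h2, h2', h])
  · obtain ⟨hPA, hPT, hB⟩ := mem_filter.1 hP
    exact ⟨(P, T \ P), mem_filter.2 ⟨mem_product.2 ⟨hPA, hB⟩, disjoint_sdiff, union_sdiff_of_subset hPT⟩, rfl⟩

omit [Fintype α] in
/-- Double counting: `Σ_{U ∈ 𝒰} #pairs(A,B)(V∖U) = Σ_{P ∈ A, P ⊆ V} #{U ∈ 𝒰 : U ⊆ V∖P, (V∖P)∖U ∈ B}` for any family `𝒰` of subsets of `V`. [this work] -/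
theorem sum_pairsAt_eq_sum_card (A B : Finset (Finset α)) (V : Finset α) {𝒰 : Finset (Finset α)} (h𝒰 : ∀ U ∈ 𝒰, U ⊆ V) :
    ∑ U ∈ 𝒰, (pairsAt A B (V \ U) : ℤ) =
      ∑ P ∈ A.filter (fun P => P ⊆ V), (#(𝒰.filter fun U => U ⊆ V \ P ∧ (V \ P) \ U ∈ B) : ℤ) := by
  have key : ∀ U ∈ 𝒰, ∀ P ∈ A, (P ⊆ V \ U ∧ (V \ U) \ P ∈ B) ↔ (P ⊆ V ∧ (U ⊆ V \ P ∧ (V \ P) \ U ∈ B)) := by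
    intro U hU P _
    have hUV := h𝒰 U hU
    rw [sdiff_sdiff_comm]
    constructor
    · rintro ⟨h1, h2⟩
      refine ⟨h1.trans sdiff_subset, ?_, h2⟩
      exact subset_sdiff.2 ⟨hUV, (subset_sdiff.1 h1).2.symm⟩
    · rintro ⟨h1, h2, h3⟩
      exact ⟨subset_sdiff.2 ⟨h1, (subset_sdiff.1 h2).2.symm⟩, h3⟩
  have hcnt : ∀ (s : Finset (Finset α)) (p : Finset α → Prop) [DecidablePred p],
      (#(s.filter p) : ℤ) = ∑ x ∈ s, (if p x then 1 else 0 : ℤ) := by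
    intro s p _; rw [card_filter]; push_cast; exact sum_congr rfl fun x _ => by split_ifs <;> simp
  calc ∑ U ∈ 𝒰, (pairsAt A B (V \ U) : ℤ)
      = ∑ U ∈ 𝒰, ∑ P ∈ A, (if P ⊆ V \ U ∧ (V \ U) \ P ∈ B then 1 else 0 : ℤ) := by
        refine sum_congr rfl fun U _ => ?_
        rw [pairsAt_eq_card_filter, hcnt]
    _ = ∑ P ∈ A, ∑ U ∈ 𝒰, (if P ⊆ V \ U ∧ (V \ U) \ P ∈ B then 1 else 0 : ℤ) := sum_comm
    _ = ∑ P ∈ A, (#(𝒰.filter fun U => P ⊆ V \ U ∧ (V \ U) \ P ∈ B) : ℤ) := by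
        refine sum_congr rfl fun P _ => ?_
        rw [hcnt]
    _ = ∑ P ∈ A, (if P ⊆ V then (#(𝒰.filter fun U => U ⊆ V \ P ∧ (V \ P) \ U ∈ B) : ℤ) else 0) := by
        refine sum_congr rfl fun P hP => ?_
        by_cases hPV : P ⊆ V
        · rw [if_pos hPV]
          congr 2
          exact filter_congr fun U hU => by rw [key U hU P hP]; exact and_iff_right hPV
        · rw [if_neg hPV]
          have : (𝒰.filter fun U => P ⊆ V \ U ∧ (V \ U) \ P ∈ B) = ∅ :=
            filter_false_of_mem fun U hU h => hPV ((key U hU P hP).1 h).1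
          rw [this, card_empty]; rfl
    _ = _ := by rw [sum_filter]

/-- The `𝒵`-debt of a small set `P` at the support `V`: `#{U ⊆ V∖P : #U ≤ 2, (V∖P)∖U ∈ Z₃}` — the number of top cubes in which `P` is complementary to a big
member of `𝒵` (memo (★): `t_𝒵(P)`). [this work] -/
def tDebt (V : Finset α) (G : Finset (Finset α)) (P : Finset α) : ℕ :=
  #((V \ P).powerset.filter fun U => #U ≤ 2 ∧ (V \ P) \ U ∈ atLeast 3 G)

/-- The `𝒵`-edge credit of a small set `P` at `V`: `#{S ⊆ V∖P : 3 ≤ #S, (V∖P)∖S ∈ Z_{<3}}` — the number of small members of `𝒵` disjoint from `P` with at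
least three idle points (memo (★): `e_𝒵(P)`). [this work] -/
def eCred (V : Finset α) (G : Finset (Finset α)) (P : Finset α) : ℕ :=
  #((V \ P).powerset.filter fun S => 3 ≤ #S ∧ (V \ P) \ S ∈ below 3 G)

omit [Fintype α] in
/-- For `P ⊆ V`: the subsets `U ⊆ V` with `p U` inside `V∖P` are the subsets of `V∖P` with `p U`. [this work] -/
theorem filter_powerset_subset_sdiff (V P : Finset α) (p q : Finset α → Prop) [DecidablePred p] [DecidablePred q] :
    ((V.powerset.filter p).filter fun U => U ⊆ V \ P ∧ q U) = (V \ P).powerset.filter fun U => p U ∧ q U := by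
  ext U
  simp only [mem_filter, mem_powerset]
  constructor
  · rintro ⟨⟨_, hp⟩, h2, hq⟩; exact ⟨h2, hp, hq⟩
  · rintro ⟨h1, hp, hq⟩; exact ⟨⟨h1.trans sdiff_subset, hp⟩, h1, hq⟩

omit [Fintype α] in
/-- **First debt block**: `Σ_{U ⊆ V, #U ≤ 2} #pairs(X_{<3}, Z₃)(V∖U) = Σ_{P ∈ X_{<3}, P ⊆ V} tDebt V 𝒵 P`. [this work] -/
theorem sum_pairsAt_below_atLeast_eq (F G : Finset (Finset α)) (V : Finset α) :
    ∑ U ∈ V.powerset.filter (fun U => #U ≤ 2), (pairsAt (below 3 F) (atLeast 3 G) (V \ U) : ℤ) =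
      ∑ P ∈ (below 3 F).filter (fun P => P ⊆ V), (tDebt V G P : ℤ) := by
  rw [sum_pairsAt_eq_sum_card _ _ V (fun U hU => mem_powerset.1 (mem_filter.1 hU).1)]
  refine sum_congr rfl fun P _ => ?_
  unfold tDebt
  rw [filter_powerset_subset_sdiff]

omit [Fintype α] in
/-- **Second (credit) block**: `Σ_{S ⊆ V, 3 ≤ #S} #pairs(X_{<3}, Z_{<3})(V∖S) = Σ_{P ∈ X_{<3}, P ⊆ V} eCred V 𝒵 P`. [this work] -/
theorem sum_pairsAt_below_below_eq (F G : Finset (Finset α)) (V : Finset α) :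
    ∑ S ∈ V.powerset.filter (fun S => 3 ≤ #S), (pairsAt (below 3 F) (below 3 G) (V \ S) : ℤ) =
      ∑ P ∈ (below 3 F).filter (fun P => P ⊆ V), (eCred V G P : ℤ) := by
  rw [sum_pairsAt_eq_sum_card _ _ V (fun U hU => mem_powerset.1 (mem_filter.1 hU).1)]
  refine sum_congr rfl fun P _ => ?_
  unfold eCred
  rw [filter_powerset_subset_sdiff]

/-- **The deal form re-indexed**: `[s^V] R_3 = Σ_{U} κ(X₃,𝒵)(∅,V∖U) − Σ_{P ∈ X_{<3}, P ⊆ V} (tDebt V 𝒵 P − eCred V 𝒵 P)` (memo (★)). [this work] -/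
theorem coeff_ind_Rt_three_eq_kap_sub_debts (F G : Finset (Finset α)) (V : Finset α) :
    (Rt 3 F G).coeff (ind V) =
      (∑ U ∈ V.powerset.filter (fun U => #U ≤ 2), kap (atLeast 3 F) G ∅ (V \ U))
      - ∑ P ∈ (below 3 F).filter (fun P => P ⊆ V), ((tDebt V G P : ℤ) - eCred V G P) := by
  rw [coeff_ind_Rt_three_eq_dealForm, sum_pairsAt_below_atLeast_eq, sum_pairsAt_below_below_eq, sum_sub_distrib]
  ring

/-! ### The deal reduction -/

/-- The CREDITS of a family of maps `M U` on the top cubes of `2^V`: pairs `(U, N)` with `U ⊆ V`, `#U ≤ 2`, `N ∈ Dcl 𝒵 (V∖U)` small (`#N ≤ 2`) and a large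
image `3 ≤ #(M U N)`. [this work] -/
def credits (V : Finset α) (G : Finset (Finset α)) (M : Finset α → Finset α → Finset α) : Finset (Finset α × Finset α) :=
  (V.powerset.filter fun U => #U ≤ 2).biUnion fun U =>
    ((Dcl G (V \ U)).filter fun N => #N ≤ 2 ∧ 3 ≤ #(M U N)).image fun N => (U, N)

omit [Fintype α] in
/-- Membership in `credits`. [this work] -/
theorem mem_credits {V : Finset α} {G : Finset (Finset α)} {M : Finset α → Finset α → Finset α} {p : Finset α × Finset α} :
    p ∈ credits V G M ↔ p.1 ⊆ V ∧ #p.1 ≤ 2 ∧ p.2 ∈ Dcl G (V \ p.1) ∧ #p.2 ≤ 2 ∧ 3 ≤ #(M p.1 p.2) := by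
  unfold credits
  simp only [mem_biUnion, mem_filter, mem_powerset, mem_image]
  constructor
  · rintro ⟨U, ⟨hUV, hU2⟩, N, ⟨hND, hN2, hM3⟩, rfl⟩
    exact ⟨hUV, hU2, hND, hN2, hM3⟩
  · rintro ⟨hUV, hU2, hND, hN2, hM3⟩
    exact ⟨p.1, ⟨hUV, hU2⟩, p.2, ⟨hND, hN2, hM3⟩, rfl⟩

/-- **THE DEAL REDUCTION (III)**.  Let `𝒳` be an up-set, `𝒵` any family, `V` a finset.  Given maps `M U` that are increasing injections of `Dcl 𝒵 (V∖U)` into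
`Ccl 𝒵 (V∖U)` for every `U ⊆ V` with `#U ≤ 2`, and a dealing `pay` with `pay (U,N) ⊆ M U N` on credits, such that every small member `P` of `𝒳` inside `V`
receives at least `tDebt V 𝒵 P − eCred V 𝒵 P` credits, the squarefree coefficient `[s^V] R_3(𝒳,𝒵)` is nonnegative.  (For loop-free `𝒳` the small members
are its edges; a dealing paying EVERY pair of `V` its `𝒵`-debt is a `𝒵`-only certificate valid for all `𝒳`, memo §4.) [this work] -/
theorem coeff_ind_Rt_three_nonneg_of_deal {F : Finset (Finset α)} (hF : IsUpperSet (F : Set (Finset α))) (G : Finset (Finset α))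
    (V : Finset α) (M : Finset α → Finset α → Finset α)
    (hMC : ∀ U ⊆ V, #U ≤ 2 → ∀ N ∈ Dcl G (V \ U), M U N ∈ Ccl G (V \ U))
    (hMsub : ∀ U ⊆ V, #U ≤ 2 → ∀ N ∈ Dcl G (V \ U), N ⊆ M U N)
    (hMinj : ∀ U ⊆ V, #U ≤ 2 → Set.InjOn (M U) (Dcl G (V \ U) : Set (Finset α)))
    (pay : Finset α × Finset α → Finset α) (hpay : ∀ p ∈ credits V G M, pay p ⊆ M p.1 p.2)
    (hdebt : ∀ P ∈ below 3 F, P ⊆ V → ((tDebt V G P : ℤ) - eCred V G P) ≤ #((credits V G M).filter fun p => pay p = P)) :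
    0 ≤ (Rt 3 F G).coeff (ind V) := by
  rw [coeff_ind_Rt_three_eq_kap_sub_debts]
  set Us := V.powerset.filter fun U => #U ≤ 2
  set Ps := (below 3 F).filter fun P => P ⊆ V
  set Cr := credits V G M
  -- (1) every cube's surplus dominates its credits whose image lies in X₃
  have h1 : ∀ U ∈ Us, (#((Dcl G (V \ U)).filter fun N => #N ≤ 2 ∧ M U N ∈ atLeast 3 F) : ℤ) ≤ kap (atLeast 3 F) G ∅ (V \ U) := by
    intro U hU
    obtain ⟨hUV, hU2⟩ := mem_filter.1 hU
    exact card_credits_le_kap hF G (V \ U) (M U) (hMC U (mem_powerset.1 hUV) hU2) (hMsub U (mem_powerset.1 hUV) hU2)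
      (hMinj U (mem_powerset.1 hUV) hU2)
  -- (2) the credits paid into `𝒳` have image in X₃, and are counted cube by cube
  have h2 : (#(Cr.filter fun p => pay p ∈ F) : ℤ) ≤ ∑ U ∈ Us, (#((Dcl G (V \ U)).filter fun N => #N ≤ 2 ∧ M U N ∈ atLeast 3 F) : ℤ) := by
    have hsub : (Cr.filter fun p => pay p ∈ F) ⊆
        Us.biUnion fun U => ((Dcl G (V \ U)).filter fun N => #N ≤ 2 ∧ M U N ∈ atLeast 3 F).image fun N => (U, N) := by
      intro p hp
      obtain ⟨hpC, hpF⟩ := mem_filter.1 hp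
      obtain ⟨hUV, hU2, hND, hN2, hM3⟩ := mem_credits.1 hpC
      refine mem_biUnion.2 ⟨p.1, mem_filter.2 ⟨mem_powerset.2 hUV, hU2⟩, mem_image.2 ⟨p.2, mem_filter.2 ⟨hND, hN2, ?_⟩, ?_⟩⟩
      · simp only [atLeast, mem_filter]
        exact ⟨hF (hpay p hpC) hpF, hM3⟩
      · rfl
    calc (#(Cr.filter fun p => pay p ∈ F) : ℤ)
        ≤ #(Us.biUnion fun U => ((Dcl G (V \ U)).filter fun N => #N ≤ 2 ∧ M U N ∈ atLeast 3 F).image fun N => (U, N)) := by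
          exact_mod_cast card_le_card hsub
      _ ≤ ∑ U ∈ Us, (#(((Dcl G (V \ U)).filter fun N => #N ≤ 2 ∧ M U N ∈ atLeast 3 F).image fun N => (U, N)) : ℤ) := by
          exact_mod_cast card_biUnion_le
      _ ≤ _ := by
          refine sum_le_sum fun U _ => ?_
          exact_mod_cast card_image_le
  -- (3) the credits paid to the small members of `𝒳` inside `V` are among those paid into `𝒳`
  have h3 : ∑ P ∈ Ps, (#(Cr.filter fun p => pay p = P) : ℤ) ≤ #(Cr.filter fun p => pay p ∈ F) := by
    have : ∑ P ∈ Ps, #(Cr.filter fun p => pay p = P) = #(Cr.filter fun p => pay p ∈ Ps) := by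
      rw [card_eq_sum_card_fiberwise (f := pay) (s := Cr.filter fun p => pay p ∈ Ps) (t := Ps) (fun p hp => (mem_filter.1 hp).2)]
      refine sum_congr rfl fun P hP => ?_
      congr 1; ext p; simp only [mem_filter]
      constructor
      · rintro ⟨h1, h2⟩; exact ⟨⟨h1, h2 ▸ hP⟩, h2⟩
      · rintro ⟨⟨h1, _⟩, h2⟩; exact ⟨h1, h2⟩
    rw [← Nat.cast_sum, this]
    have hsub3 : (Cr.filter fun p => pay p ∈ Ps) ⊆ (Cr.filter fun p => pay p ∈ F) := fun p hp => by
      rw [mem_filter] at hp ⊢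
      exact ⟨hp.1, (mem_filter.1 (mem_filter.1 hp.2).1).1⟩
    exact_mod_cast card_le_card hsub3
  -- (4) debts
  have h4 : ∑ P ∈ Ps, ((tDebt V G P : ℤ) - eCred V G P) ≤ ∑ P ∈ Ps, (#(Cr.filter fun p => pay p = P) : ℤ) :=
    sum_le_sum fun P hP => hdebt P (mem_filter.1 hP).1 (mem_filter.1 hP).2
  have h5 : ∑ U ∈ Us, (#((Dcl G (V \ U)).filter fun N => #N ≤ 2 ∧ M U N ∈ atLeast 3 F) : ℤ) ≤
      ∑ U ∈ Us, kap (atLeast 3 F) G ∅ (V \ U) := sum_le_sum h1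
  linarith

end Summit.CriticalPhenomena.PercolationContinuityZ3.Theorems.SahiCTCForms
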